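import Mathlib

/-!
# HodgeLocusCensusLemmaR2 — the 2-adic unit lemma behind THEOREM R2♭ of the `N = 1` Hodge-locus census (pub-hlocus, ENGINE B, abs-2 gen 22)

HONEST FRAMING: certified instances and evidence bearing on the general Hodge conjecture; no claim.

CELL V3-XT, `N = 1` (`DERIVATIONS_engineB.md` §14.4).  For an imaginary quadratic discriminant `D = D₀f²` with `2 | D₀`, `2 ∤ f`, `D ≠ −4`,
`θ = j(O_D)`, `L = K(θ)` the ring class field and `𝔓 | 2` a prime of `L` (so `v_𝔓(2) = 2`), a good-reduction CM model has `v_𝔓(a₁) = 1`, `a₃` a unit, and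
`c₄ = a₁⁴(1 + w)` with `v_𝔓(w) = 3`; since `α₀ = θ(θ − 1728) = c₄·(c₄c₆/Δ)²`, THEOREM R2♭ (`α₀ ∉ L_𝔓^{×2}`) reduces to the elementary
**LEMMA (2-adic, `e = 2`): in a valued field with `v(2)` "= 2" and `v(w)` "= 3" (additively), `1 + w` is not a square.**
The CM input (`v_𝔓(a₁) = 1` from the formal `O_K ⊗ ℤ₂`-module) is NOT formalised — Mathlib has no ring class fields; this file is the valuation-theoretic kernel:

* `dichotomy`        : for ANY valuation `v : Valuation K Γ₀` and `y² = 1 + w`: either `v w` is a square in `Γ₀` (`v(y − 1) = v(y + 1)`), or `v w = g · v 2` with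
                       `g < v 2` (the two factors `y ∓ 1` differ by `2`, so the larger value equals `v 2`);
* `not_sq`           : contrapositive packaging — if `v w` is not a square and is not of the form `g · v 2` with `g < v 2`, then `1 + w` is not a square;
* `not_sq_int`       : the discrete instance used in §14.4: `Γ₀ = ℤₘ₀`, `v 2 = ofAdd (−2)`, `v w = ofAdd (−3)` ⟹ `¬ ∃ y, y² = 1 + w`
                       (additively: `3` is odd, and `3 = g + 2` forces `g = 1 < 2`, i.e. `g` is NOT of smaller value than `v 2`);
* `anchor_D8`        : the `h = 1` instance `D = −8`, `θ = 8000 = 2⁶·5³`, `θ − 1728 = 6272 = 2⁷·7²` (ℚ₂-valuations `6 = 12/2` and `7 = 14/2`: PROP R2 and R2′ for `D₀ ≡ 0 (mod 8)`),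
                       `θ(θ − 1728) = 2¹³·6125` with `6125` odd.
Multiplicative conventions as in `HodgeLocusCensusLemmaW`: value `1` = unit, `< 1` = positive valuation.  Source: `data/abs/engineB/DERIVATIONS_engineB.md` §14 (pub-hlocus HOME);
companion data: kit job ssB (square level of the unit part of `α₀` equal to `3` for every certified root, every `2 | D₀`, `2 ∤ f`, `|D| ≤ 10⁴`) — consistency evidence only.
-/

namespace Summit.HodgeConjecture.HodgeConjecture.HodgeLocus.Census.LemmaR2

variable {K Γ₀ : Type*} [Field K] [LinearOrderedCommGroupWithZero Γ₀] (v : Valuation K Γ₀)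

/-- If `y² = 1 + w` then either `v w` is a square in the value group, or `v w = g · v 2` with `g < v 2`. -/
theorem dichotomy (y w : K) (hy : y ^ 2 = 1 + w) :
    (∃ g : Γ₀, v w = g * g) ∨ (∃ g : Γ₀, g < v 2 ∧ v w = g * v 2) := by
  have hw : w = (y - 1) * (y + 1) := by linear_combination -hy
  have htwo : (2 : K) = (y + 1) - (y - 1) := by ring
  have hvw : v w = v (y - 1) * v (y + 1) := by rw [hw, map_mul]
  rcases lt_trichotomy (v (y - 1)) (v (y + 1)) with h | h | h
  · -- v(y-1) < v(y+1) = v 2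
    have h2 : v (2 : K) = v (y + 1) := by
      rw [htwo]; exact Valuation.map_sub_eq_of_lt_left v h
    exact Or.inr ⟨v (y - 1), by rw [h2]; exact h, by rw [hvw, h2]⟩
  · exact Or.inl ⟨v (y - 1), by rw [hvw, h]⟩
  · -- v(y+1) < v(y-1) = v 2
    have h2 : v (2 : K) = v (y - 1) := by
      rw [htwo]; exact Valuation.map_sub_eq_of_lt_right v h
    exact Or.inr ⟨v (y + 1), by rw [h2]; exact h, by rw [hvw, h2, mul_comm]⟩

/-- Packaging: `1 + w` is not a square as soon as `v w` is neither a square in `Γ₀` nor of the form `g · v 2` with `g < v 2`. -/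
theorem not_sq (w : K) (h1 : ∀ g : Γ₀, v w ≠ g * g) (h2 : ∀ g : Γ₀, g < v 2 → v w ≠ g * v 2) :
    ¬ ∃ y : K, y ^ 2 = 1 + w := by
  rintro ⟨y, hy⟩
  rcases dichotomy v y w hy with ⟨g, hg⟩ | ⟨g, hlt, hg⟩
  · exact h1 g hg
  · exact h2 g hlt hg

end Summit.HodgeConjecture.HodgeConjecture.HodgeLocus.Census.LemmaR2

namespace Summit.HodgeConjecture.HodgeConjecture.HodgeLocus.Census.LemmaR2

open Multiplicative in
/-- The discrete instance of §14.4 (`e(𝔓 | 2) = 2`, `v_𝔓(w) = 3`): with values in `ℤₘ₀`, `v 2 = ofAdd (-2)` and `v w = ofAdd (-3)` make `1 + w` a non-square. -/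
theorem not_sq_int {K : Type*} [Field K] (v : Valuation K (WithZero (Multiplicative ℤ))) (w : K)
    (h2 : v 2 = ((ofAdd (-2 : ℤ) : Multiplicative ℤ) : WithZero (Multiplicative ℤ)))
    (hw : v w = ((ofAdd (-3 : ℤ) : Multiplicative ℤ) : WithZero (Multiplicative ℤ))) :
    ¬ ∃ y : K, y ^ 2 = 1 + w := by
  apply not_sq v w
  · intro g hg
    rw [hw] at hg
    induction g using WithZero.recZeroCoe with
    | zero => simp at hg
    | coe a =>
      rw [← WithZero.coe_mul, WithZero.coe_inj] at hg
      have : (-3 : ℤ) = toAdd a + toAdd a := by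
        have := congrArg toAdd hg
        simpa using this
      omega
  · intro g hlt hg
    rw [hw, h2] at hg
    rw [h2] at hlt
    induction g using WithZero.recZeroCoe with
    | zero => simp at hg
    | coe a =>
      rw [← WithZero.coe_mul, WithZero.coe_inj] at hg
      rw [WithZero.coe_lt_coe] at hlt
      have h3 : (-3 : ℤ) = toAdd a + (-2) := by
        have := congrArg toAdd hg
        simpa using this
      have h4 : toAdd a < -2 := by
        have := Multiplicative.toAdd_lt.mpr hlt
        simpa using this
      omega

/-- Anchor `D = −8` (`h = 1`, `θ = j(ℤ[√−2]) = 8000`): `θ = 2⁶·5³`, `θ − 1728 = 2⁷·7²`, `θ(θ − 1728) = 2¹³·6125`, `6125` odd — so the ℚ₂-valuations are `6`, `7`, `13`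
(`= 12/2`, `14/2` in the `𝔓`-normalisation of PROP R2 / R2′, `D₀ = −8 ≡ 0 (mod 8)`). -/
theorem anchor_D8 : (8000 : ℤ) = 2 ^ 6 * 5 ^ 3 ∧ (8000 : ℤ) - 1728 = 2 ^ 7 * 7 ^ 2 ∧ (8000 : ℤ) * (8000 - 1728) = 2 ^ 13 * 6125 ∧ 6125 % 2 = 1 := by
  norm_num

end Summit.HodgeConjecture.HodgeConjecture.HodgeLocus.Census.LemmaR2
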